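import Mathlib
import Summits.CriticalPhenomena.SAWScalingLimit.Theses.SAWLeftRightFKG
import Literature.Probability.RandomPlanarGeometry.SelfAvoidingWalkProofs
import Literature.Topology.PlaneTopology.AnnulusArcs
import HarnessLib

/-!
# Vocabulary of line `corner-localisation` for crux `LeftRightFKG` (stmt-CriticalPhenomena-11232)

Route `route-CriticalPhenomena-SAWLeftRightFKG`, crux decl
`Summit.CriticalPhenomena.SAWScalingLimit.Theses.SAWLeftRightFKG.LeftRightFKG` (left–right positive
association of the critical square-lattice SAW chord measure in a simply connected lattice domain between
boundary-adjacent endpoints). This file is the SHARED VOCABULARY of the registered skeleton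
`Cruxes/LeftRightFKG/Lines/corner-localisation.lean` (lead's reshape, 2026-08-16; `ledger skeleton check`:
6 stubs `stub_meshReduction`, `stub_loopWindVanish`, `stub_stepMonotone`, `stub_endpointMonotone`,
`stub_chebyshev`, `stub_corner`), so that the stub proofs — which land one file each under
`Theorems/SAWLeftRightFKGLeftRightFKGStub*.lean` — state the registered signatures against the SAME
constants, and the final composition imports them.

Contents (namespace `Summit.CriticalPhenomena.SAWScalingLimit.Theorems.LeftRightFKG.CornerLoc`):

* transparent names for the crux's own `let`-terms: `dom C δ` (the domain `{wind(C_δ, ·) ≠ 0}`), `lr`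
  (the left–right order: the lens loop winds non-negatively about every point), `IsUp`, `μx x` (the
  fugacity-`x` chord measure; `SAW.weight = μx x_c` by `rfl`), `IsInst` (the crux's hypotheses);
* the induction's bookkeeping INSIDE one chord type `SAW.DomainSAW (dom C δ) δ a b`: prefix/suffix classes
  `cls k π m σ` (`AgreeTo`, `AgreeToR`), the sets `restrP k π m σ Sa Sb` (next step in `Sa`, previous step in
  `Sb`), relative up-sets `IsUpOn`, step-determined events `NextDet`, `PrevDet`;
* the graded statement `PAfor x needNext needPrev` with its three levels `Corner x ⊂ EndMono x ⊂ PA x`;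
* the statements of the registered stubs as named `Prop`s: `StepMonotone`, `MeshReduction`,
  `LoopWindVanish` (infrastructure / geometric inputs), `CornerToEndMono`, `EndMonoToPA` (fugacity-blind
  inductions), `CornerCritical` (the `x ≤ x_c` content). These are DEFINITIONS USED AS HYPOTHESIS NAMES of
  the line's stubs (each will be witnessed by a `stub_*` theorem in its own file), not literature facts and
  not restatements of the crux: `CornerCritical` is the line's Transfer target `C⁺` (corner positivity of
  all slit sub-instances), strictly finer-grained than the crux;
* small closed lemmas every stub prover needs: `cls_zero`, `restrP_zero_univ`, `isUpOn_of_isUp`,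
  `IsUpOn.mono`, `weight_eq_μx`, `isBounded_dom`, `support_subset_of_walk`, `finite_domainSAW`
  (finiteness of the chord type for `δ > 0`; adapted from the sibling skeleton
  `Lines/kesten_cone_certificate.lean`, planner-cruxplan-…-kesten-cone-certific-0), `μx_apply_finset`
  (the measure of a set is the finite sum of the weights).

Design choice (lead's reshape of the planner's skeleton): the two-sided domain Markov property is NOT a
stub — conditioning on a common prefix/suffix is a re-description of the same set of chords with longer
`π`/`σ`, so no boundary-walk surgery and no `meshDomain` largest-component bookkeeping is ever needed; the
only topological inputs are `LoopWindVanish` (simple connectivity: a closed walk of `Ω_1` does not wind about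
points off `Ω`) and the local crossing-count analysis inside `StepMonotone`.
-/

noncomputable section

open MeasureTheory
open Literature.Probability.LatticeModels Literature.Probability.RandomPlanarGeometry
open Literature.Topology.PlaneTopology
open scoped Classical ENNReal

namespace Summit.CriticalPhenomena.SAWScalingLimit.Theorems.LeftRightFKG.CornerLoc

/-! ## Vocabulary — transparent names for the crux's own `let`-terms -/

/-- The crux's domain `Ω(C, δ) = {z | wind(δ-polyline of C, z) ≠ 0}`: verbatim the `let Ω` of
`SAWLeftRightFKG.LeftRightFKG`. [folklore] -/
def dom {c : Site 2} (C : (zdGraph 2).Walk c c) (δ : ℝ) : Set ℂ :=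
  {z | wind (fun t : ℝ => Set.IccExtend zero_le_one (C.toCurve (meshPoint δ)) t - z) ≠ 0}

/-- The crux's left–right order `γ₁ ≼ γ₂` (lens loop `γ₁ · γ₂⁻¹` has winding `≥ 0` everywhere):
verbatim its `let le`. [folklore] -/
def lr {Ω : Set ℂ} {δ : ℝ} {a b : Site 2} (γ₁ γ₂ : SAW.DomainSAW Ω δ a b) : Prop :=
  ∀ z : ℂ, 0 ≤ wind
    (fun t : ℝ => Set.IccExtend zero_le_one
      ((γ₁.walk.append γ₂.walk.reverse).toCurve (meshPoint δ)) t - z)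

/-- `A` is up-closed for `≼` (the crux's hypothesis on `A`, `B`). [folklore] -/
def IsUp {Ω : Set ℂ} {δ : ℝ} {a b : Site 2} (A : Set (SAW.DomainSAW Ω δ a b)) : Prop :=
  ∀ γ₁ γ₂, lr γ₁ γ₂ → γ₁ ∈ A → γ₂ ∈ A

/-- `A` is up-closed for `≼` RELATIVE to the class `Pc` (only comparisons inside `Pc` count). [folklore] -/
def IsUpOn {Ω : Set ℂ} {δ : ℝ} {a b : Site 2} (Pc A : Set (SAW.DomainSAW Ω δ a b)) : Prop :=
  ∀ γ₁ γ₂, γ₁ ∈ Pc → γ₂ ∈ Pc → lr γ₁ γ₂ → γ₁ ∈ A → γ₂ ∈ A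

/-- The chord agrees with the vertex sequence `π` on its first `k + 1` positions
(`γ(i) = π i` for `i ≤ k`; `SimpleGraph.Walk.getVert` saturates at `b` beyond the length). [folklore] -/
def AgreeTo {Ω : Set ℂ} {δ : ℝ} {a b : Site 2} (k : ℕ) (π : ℕ → Site 2)
    (γ : SAW.DomainSAW Ω δ a b) : Prop :=
  ∀ i ≤ k, γ.walk.getVert i = π i

/-- The REVERSED chord agrees with `σ` on its first `m + 1` positions (the last `m + 1` vertices of
`γ` are `σ 0 = b, σ 1, …, σ m`). [folklore] -/
def AgreeToR {Ω : Set ℂ} {δ : ℝ} {a b : Site 2} (m : ℕ) (σ : ℕ → Site 2)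
    (γ : SAW.DomainSAW Ω δ a b) : Prop :=
  ∀ j ≤ m, γ.walk.reverse.getVert j = σ j

/-- The PREFIX/SUFFIX CLASS: chords with prescribed first `k + 1` and last `m + 1` vertices. At
`k = m = 0`, `π 0 = a`, `σ 0 = b` this is everything (`cls_zero`). [folklore] -/
def cls {Ω : Set ℂ} {δ : ℝ} {a b : Site 2} (k : ℕ) (π : ℕ → Site 2) (m : ℕ) (σ : ℕ → Site 2) :
    Set (SAW.DomainSAW Ω δ a b) :=
  {γ | AgreeTo k π γ ∧ AgreeToR m σ γ}

/-- The induction's sets `Γ`: a prefix/suffix class with the NEXT step (vertex `k + 1`) in `Sa` and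
the PREVIOUS step (vertex `m + 1` from the end) in `Sb`. [folklore] -/
def restrP {Ω : Set ℂ} {δ : ℝ} {a b : Site 2} (k : ℕ) (π : ℕ → Site 2) (m : ℕ) (σ : ℕ → Site 2)
    (Sa Sb : Set (Site 2)) : Set (SAW.DomainSAW Ω δ a b) :=
  {γ | γ ∈ cls k π m σ ∧ γ.walk.getVert (k + 1) ∈ Sa ∧ γ.walk.reverse.getVert (m + 1) ∈ Sb}

/-- `A` depends only on the next step after position `k`. [folklore] -/
def NextDet {Ω : Set ℂ} {δ : ℝ} {a b : Site 2} (k : ℕ) (A : Set (SAW.DomainSAW Ω δ a b)) : Prop :=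
  ∀ γ₁ γ₂, γ₁.walk.getVert (k + 1) = γ₂.walk.getVert (k + 1) → (γ₁ ∈ A ↔ γ₂ ∈ A)

/-- `B` depends only on the previous step before position `m` from the end. [folklore] -/
def PrevDet {Ω : Set ℂ} {δ : ℝ} {a b : Site 2} (m : ℕ) (B : Set (SAW.DomainSAW Ω δ a b)) : Prop :=
  ∀ γ₁ γ₂, γ₁.walk.reverse.getVert (m + 1) = γ₂.walk.reverse.getVert (m + 1) → (γ₁ ∈ B ↔ γ₂ ∈ B)

/-- The fugacity-`x` chord measure `γ ↦ x^{|γ|}`, a sum of weighted Dirac masses (same shape as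
`SAW.weight`, which is the case `x = x_c`, by `rfl`: `weight_eq_μx`). [folklore] -/
def μx (x : ℝ) (Ω : Set ℂ) (δ : ℝ) (a b : Site 2) : Measure (SAW.DomainSAW Ω δ a b) :=
  Measure.sum fun γ => ENNReal.ofReal (x ^ γ.length) • Measure.dirac γ

/-- The crux's weight is the fugacity-`x_c` instance of `μx` — definitionally. [folklore] -/
theorem weight_eq_μx (Ω : Set ℂ) (δ : ℝ) (a b : Site 2) :
    SAW.weight Ω δ a b = μx SAW.criticalFugacity Ω δ a b := rfl

/-- The crux's instance hypotheses: positive mesh, `a'`, `b'` on the boundary walk, `a ∼ a'`,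
`b ∼ b'`. [folklore] -/
def IsInst (δ : ℝ) {c : Site 2} (a b a' b' : Site 2) (C : (zdGraph 2).Walk c c) : Prop :=
  0 < δ ∧ a' ∈ C.support ∧ b' ∈ C.support ∧ (zdGraph 2).Adj a a' ∧ (zdGraph 2).Adj b b'

/-! ## The graded positive-association statement -/

/-- `PAfor x needNext needPrev`: for every crux instance, every prefix/suffix class `cls k π m σ`, every
next/previous-step restriction `Γ = restrP k π m σ Sa Sb` and all sets `A`, `B` up-closed relative to the
class — with `A` next-step-determined if `needNext`, `B` previous-step-determined if `needPrev` — the PA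
inequality `μ(A ∩ Γ) μ(B ∩ Γ) ≤ μ(Γ) μ(A ∩ B ∩ Γ)` for `μ = μx x`. [folklore] -/
def PAfor (x : ℝ) (needNext needPrev : Bool) : Prop :=
  ∀ (δ : ℝ) (c a b a' b' : Site 2) (C : (zdGraph 2).Walk c c), IsInst δ a b a' b' C →
    ∀ (k : ℕ) (π : ℕ → Site 2) (m : ℕ) (σ : ℕ → Site 2) (Sa Sb : Set (Site 2))
      (A B : Set (SAW.DomainSAW (dom C δ) δ a b)),
      IsUpOn (cls k π m σ) A → IsUpOn (cls k π m σ) B →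
      (needNext = true → NextDet k A) → (needPrev = true → PrevDet m B) →
      μx x (dom C δ) δ a b (A ∩ restrP k π m σ Sa Sb) * μx x (dom C δ) δ a b (B ∩ restrP k π m σ Sa Sb) ≤
        μx x (dom C δ) δ a b (restrP k π m σ Sa Sb) *
          μx x (dom C δ) δ a b (A ∩ B ∩ restrP k π m σ Sa Sb)

/-- CORNER POSITIVITY at fugacity `x`: `PAfor` for (next-step up-event, previous-step up-event) only —
one bilinear inequality among four partition functions per (sub-)instance. [folklore] -/
abbrev Corner (x : ℝ) : Prop := PAfor x true true

/-- ENDPOINT MONOTONICITY at fugacity `x`: `PAfor` for (next-step up-event `E`, arbitrary relative up-set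
`U`) — i.e. `P(U | E) ≥ P(U | Eᶜ)` — and its mirror at the far end. [folklore] -/
abbrev EndMono (x : ℝ) : Prop := PAfor x true false ∧ PAfor x false true

/-- FULL POSITIVE ASSOCIATION at fugacity `x` for all classes and restrictions; `k = m = 0`,
`Sa = Sb = univ`, `x = x_c` is the crux verbatim. [folklore] -/
abbrev PA (x : ℝ) : Prop := PAfor x false false

/-! ## Statements of the registered stubs -/

/-- STEP-RANK MONOTONICITY along prefix classes (+ finiteness) — statement witnessed by the registered
stub `stub_stepMonotone : MeshReduction → LoopWindVanish → StepMonotone`: for every crux instance the chord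
type is finite, and for every `k`, `π` there is a ranking of the lattice neighbours of `π k`, injective on
the neighbour set, such that among chords agreeing with `π` up to position `k` the rank of the vertex at
position `k + 1` is monotone in `≼`; mirror statement for reversed chords. Content (`k = 0`, `π 0 = a`):
the lens `γ₁·γ₂⁻¹` has winding `0` in the sector at `a` containing `a'` (on the boundary trace, joined to
infinity off the lens) and `±1` in the complementary sector, forcing the angular order from `a'`; for
`k ≥ 1` the same at `p = π k` with `p' = π (k-1)` in the role of `a'`. Classes with `≤ 1` chord are trivial.
Uses `Adj a a'`/`Adj b b'` (necessary: `Negative.WithoutBoundaryAdjacency`). [cite: Ahlfors1979, §4.2.1] -/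
def StepMonotone : Prop :=
  ∀ (δ : ℝ) (c a b a' b' : Site 2) (C : (zdGraph 2).Walk c c), IsInst δ a b a' b' C →
    Finite (SAW.DomainSAW (dom C δ) δ a b) ∧
    (∀ (k : ℕ) (π : ℕ → Site 2), ∃ r : Site 2 → ℕ, Set.InjOn r ((zdGraph 2).neighborSet (π k)) ∧
      ∀ γ₁ γ₂ : SAW.DomainSAW (dom C δ) δ a b, AgreeTo k π γ₁ → AgreeTo k π γ₂ → lr γ₁ γ₂ →
        r (γ₁.walk.getVert (k + 1)) ≤ r (γ₂.walk.getVert (k + 1))) ∧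
    (∀ (m : ℕ) (σ : ℕ → Site 2), ∃ r : Site 2 → ℕ, Set.InjOn r ((zdGraph 2).neighborSet (σ m)) ∧
      ∀ γ₁ γ₂ : SAW.DomainSAW (dom C δ) δ a b, AgreeToR m σ γ₁ → AgreeToR m σ γ₂ → lr γ₁ γ₂ →
        r (γ₁.walk.reverse.getVert (m + 1)) ≤ r (γ₂.walk.reverse.getVert (m + 1)))

/-- MESH REDUCTION — statement witnessed by the registered stub `stub_meshReduction` (everything scales):
for `δ > 0` the chords of `(C, δ)` and of `(C, 1)` are in a support-preserving bijection which preserves the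
left–right order (`dom C δ = δ • dom C 1`, the mesh graphs coincide,
`toCurve (meshPoint δ) = δ • toCurve (meshPoint 1)`, `wind (δ • loop) = wind loop`). [folklore] -/
def MeshReduction : Prop :=
  ∀ (δ : ℝ) (c a b : Site 2) (C : (zdGraph 2).Walk c c), 0 < δ →
    ∃ e : SAW.DomainSAW (dom C δ) δ a b ≃ SAW.DomainSAW (dom C 1) 1 a b,
      (∀ γ, (e γ).walk.support = γ.walk.support) ∧
      (∀ γ₁ γ₂, lr γ₁ γ₂ ↔ lr (e γ₁) (e γ₂))

/-- LOOP WINDING VANISHES OFF THE DOMAIN — statement witnessed by the registered stub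
`stub_loopWindVanish` (the simple-connectivity input): a closed walk of the discrete domain `Ω_1`,
`Ω = dom C 1`, has winding number `0` about every point NOT in `Ω` (trace points of `C`, the exterior,
slits). Content: `ℂ ∖ Ω` is connected (every complementary component of the trace of `C` of index `0` has
its frontier on the connected trace), it misses the trace of the walk, and the winding number vanishes far
away. [folklore] -/
def LoopWindVanish : Prop :=
  ∀ (c u : Site 2) (C : (zdGraph 2).Walk c c) (L : (discreteDomainGraph (dom C 1) 1).Walk u u) (z : ℂ),
    z ∉ dom C 1 →
      wind (fun t : ℝ => Set.IccExtend zero_le_one (L.toCurve (meshPoint 1)) t - z) = 0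

/-- Statement witnessed by the registered stub `stub_endpointMonotone` (the card's pivot;
fugacity-blind): given step-rank monotonicity, corner positivity at fugacity `x` propagates to endpoint
monotonicity at fugacity `x`, for every `x > 0`. [cite: EsaryProschanWalkup1967] -/
def CornerToEndMono : Prop :=
  StepMonotone → ∀ x : ℝ, 0 < x → Corner x → EndMono x

/-- Statement witnessed by the registered stub `stub_chebyshev` (Harris/CIS-type induction;
fugacity-blind): given step-rank monotonicity, one-ended monotonicity at fugacity `x` propagates to full
positive association at fugacity `x`, for every `x > 0`. [cite: Harris1960] -/
def EndMonoToPA : Prop :=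
  StepMonotone → ∀ x : ℝ, 0 < x → PAfor x true false → PA x

/-- Statement witnessed by the registered stub `stub_corner` (the `x ≤ x_c` content of the line; its
Transfer target `C⁺`, OPEN): corner positivity AT `x_c` for every crux instance, every prefix/suffix class
and every next/previous-step restriction. Not the crux and not a literature fact: a hypothesis name.
[folklore] -/
def CornerCritical : Prop :=
  Corner SAW.criticalFugacity

/-! ## Basic closed lemmas -/

section Basic

variable {Ω : Set ℂ} {δ : ℝ} {a b : Site 2}

/-- The trivial prefix/suffix class is everything: position `0` of a chord is `a`, position `0` of the
reversed chord is `b`. [folklore] -/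
theorem cls_zero : (cls 0 (fun _ => a) 0 (fun _ => b) : Set (SAW.DomainSAW Ω δ a b)) = Set.univ := by
  ext γ
  simp only [cls, AgreeTo, AgreeToR, Set.mem_setOf_eq, Set.mem_univ, iff_true]
  refine ⟨fun i hi => ?_, fun j hj => ?_⟩
  · rw [Nat.le_zero.1 hi, SimpleGraph.Walk.getVert_zero]
  · rw [Nat.le_zero.1 hj, SimpleGraph.Walk.getVert_zero]

/-- With the trivial class and no step restriction, `restrP` is everything. [folklore] -/
theorem restrP_zero_univ :
    (restrP 0 (fun _ => a) 0 (fun _ => b) Set.univ Set.univ : Set (SAW.DomainSAW Ω δ a b)) = Set.univ := by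
  ext γ
  simp only [restrP, cls_zero, Set.mem_univ, true_and, Set.mem_setOf_eq]

/-- A globally up-closed set is up-closed relative to any class. [folklore] -/
theorem isUpOn_of_isUp {Pc A : Set (SAW.DomainSAW Ω δ a b)} (h : IsUp A) : IsUpOn Pc A :=
  fun γ₁ γ₂ _ _ h₁₂ h₁ => h γ₁ γ₂ h₁₂ h₁

/-- Relative up-closedness restricts to sub-classes. [folklore] -/
theorem IsUpOn.mono {Pc Pc' A : Set (SAW.DomainSAW Ω δ a b)} (h : IsUpOn Pc A) (hP : Pc' ⊆ Pc) :
    IsUpOn Pc' A :=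
  fun γ₁ γ₂ h₁ h₂ h₁₂ hA => h γ₁ γ₂ (hP h₁) (hP h₂) h₁₂ hA

/-- A longer prefix agreement implies the shorter one. [folklore] -/
theorem AgreeTo.of_le {k k' : ℕ} {π : ℕ → Site 2} {γ : SAW.DomainSAW Ω δ a b} (h : AgreeTo k' π γ)
    (hk : k ≤ k') : AgreeTo k π γ :=
  fun i hi => h i (hi.trans hk)

/-- A longer suffix agreement implies the shorter one. [folklore] -/
theorem AgreeToR.of_le {m m' : ℕ} {σ : ℕ → Site 2} {γ : SAW.DomainSAW Ω δ a b} (h : AgreeToR m' σ γ)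
    (hm : m ≤ m') : AgreeToR m σ γ :=
  fun j hj => h j (hj.trans hm)

/-- The measure of a set of chords is the sum of the weights of its members (`⊤` σ-algebra). [folklore] -/
theorem μx_apply (x : ℝ) (S : Set (SAW.DomainSAW Ω δ a b)) :
    μx x Ω δ a b S = ∑' γ, S.indicator (fun γ => ENNReal.ofReal (x ^ γ.length)) γ := by
  rw [μx, Measure.sum_apply _ MeasurableSpace.measurableSet_top]
  refine tsum_congr fun γ => ?_
  rw [Measure.smul_apply, Measure.dirac_apply' _ MeasurableSpace.measurableSet_top, smul_eq_mul]
  by_cases hγ : γ ∈ S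
  · simp [Set.indicator_of_mem hγ]
  · simp [Set.indicator_of_notMem hγ]

/-- On a finite chord type the measure of a set is a finite sum of weights. [folklore] -/
theorem μx_apply_finset [Fintype (SAW.DomainSAW Ω δ a b)] (x : ℝ) (S : Set (SAW.DomainSAW Ω δ a b)) :
    μx x Ω δ a b S = ∑ γ ∈ Finset.univ.filter (· ∈ S), ENNReal.ofReal (x ^ γ.length) := by
  rw [μx_apply, tsum_fintype, Finset.sum_filter]
  refine Finset.sum_congr rfl fun γ _ => ?_
  by_cases hγ : γ ∈ S
  · simp [hγ]
  · simp [hγ]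

/-- On a finite chord type, for `x ≥ 0`, the measure of a set is `ofReal` of the real partition function
`Σ_{γ ∈ S} x^{|γ|}`. [folklore] -/
theorem μx_apply_eq_ofReal [Fintype (SAW.DomainSAW Ω δ a b)] {x : ℝ} (hx : 0 ≤ x)
    (S : Set (SAW.DomainSAW Ω δ a b)) :
    μx x Ω δ a b S = ENNReal.ofReal (∑ γ ∈ Finset.univ.filter (· ∈ S), x ^ γ.length) := by
  rw [μx_apply_finset, ENNReal.ofReal_sum_of_nonneg fun γ _ => pow_nonneg hx _]

end Basic

/-! ## Finiteness of the chord type of a crux instance -/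

section Finiteness

/-- Off loops `wind` is the junk value `0`. [folklore] -/
theorem wind_eq_zero_of_ne {f : ℝ → ℂ} (h : f 0 ≠ f 1) : wind f = 0 := by
  rw [wind, dif_neg (fun hh => h hh.2)]

/-- The crux's domain is bounded: a loop does not wind about points farther from `Γ 0` than its
whole range (`wind_sub_eq_zero_of_dist_le`). Adapted from `Lines/kesten_cone_certificate.lean`. [folklore] -/
theorem isBounded_dom {c : Site 2} (C : (zdGraph 2).Walk c c) (δ : ℝ) :
    Bornology.IsBounded (dom C δ) := by
  set Γ : ℝ → ℂ := fun t => Set.IccExtend zero_le_one (C.toCurve (meshPoint δ)) t with hΓ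
  by_cases h01 : Γ 0 = Γ 1
  · have hcont : Continuous Γ := (C.toCurve (meshPoint δ)).continuous.Icc_extend'
    have hrange : Set.range Γ = Set.range (C.toCurve (meshPoint δ)) := Set.IccExtend_range _ _
    have hbdd : Bornology.IsBounded (Set.range Γ) := by
      rw [hrange]
      exact (isCompact_range (C.toCurve (meshPoint δ)).continuous).isBounded
    obtain ⟨r, hr⟩ := hbdd.subset_closedBall (Γ 0)
    refine (Metric.isBounded_closedBall (x := Γ 0) (r := r)).subset ?_
    intro z hz
    by_contra hzr
    rw [Metric.mem_closedBall, not_le] at hzr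
    exact hz (wind_sub_eq_zero_of_dist_le hcont.continuousOn h01
      (fun t _ => Metric.mem_closedBall.1 (hr ⟨t, rfl⟩)) hzr)
  · have hempty : dom C δ = ∅ := by
      ext z
      simp only [Set.mem_empty_iff_false, iff_false]
      intro hz
      exact hz (wind_eq_zero_of_ne (fun h => h01 (sub_left_injective h)))
    rw [hempty]
    exact Bornology.isBounded_empty

/-- The vertices of a walk of `Ω_δ` are its initial vertex or vertices of `meshDomain Ω δ`. [folklore] -/
theorem support_subset_of_walk {Ω : Set ℂ} {δ : ℝ} {u v : Site 2}
    (w : (discreteDomainGraph Ω δ).Walk u v) :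
    ∀ z ∈ w.support, z = u ∨ z ∈ meshDomain Ω δ := by
  induction w with
  | nil => intro z hz; left; simpa using hz
  | @cons u' v' w' h p ih =>
    intro z hz
    rw [SimpleGraph.Walk.support_cons, List.mem_cons] at hz
    rcases hz with rfl | hz
    · exact Or.inl rfl
    · right
      rcases ih z hz with rfl | hz'
      · exact (discreteDomainGraph_adj_iff.1 h).2.2
      · exact hz'

/-- FINITENESS of the chord type of a crux instance (`δ > 0`): a chord is a duplicate-free list of sites
of the finite set `{a} ∪ meshDomain Ω δ` (`meshDomain_finite`, `isBounded_dom`). Adapted from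
`Lines/kesten_cone_certificate.lean`. [folklore] -/
theorem finite_domainSAW {c a b : Site 2} (C : (zdGraph 2).Walk c c) {δ : ℝ} (hδ : 0 < δ) :
    Finite (SAW.DomainSAW (dom C δ) δ a b) := by
  set S : Set (Site 2) := insert a (meshDomain (dom C δ) δ) with hS
  haveI : Finite S := ((meshDomain_finite (isBounded_dom C δ) hδ).insert a).to_subtype
  letI : Fintype S := Fintype.ofFinite S
  have hsupp : ∀ γ : SAW.DomainSAW (dom C δ) δ a b, ∀ z ∈ γ.walk.support, z ∈ S := fun γ z hz => by
    rcases support_subset_of_walk γ.walk z hz with h | h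
    · rw [h]; exact Set.mem_insert _ _
    · exact Set.mem_insert_of_mem _ h
  let φ : SAW.DomainSAW (dom C δ) δ a b → List S := fun γ =>
    γ.walk.support.pmap (fun v hv => ⟨v, hv⟩) (hsupp γ)
  have hφval : ∀ γ, (φ γ).map Subtype.val = γ.walk.support := by
    intro γ
    simp only [φ, List.map_pmap, List.pmap_eq_map, List.map_id']
  have hφinj : Function.Injective φ := by
    intro γ γ' h
    have h' := congrArg (List.map Subtype.val) h
    rw [hφval, hφval] at h'
    have hw : γ.walk = γ'.walk := SimpleGraph.Walk.ext_support h'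
    cases γ; cases γ'; cases hw; rfl
  have hφlen : ∀ γ, (φ γ).length ≤ Fintype.card S := fun γ =>
    List.Nodup.length_le_card
      ((γ.isPath.support_nodup).pmap (by intro _ _ _ _ h; exact congrArg Subtype.val h))
  haveI : Finite {l : List S // l.length ≤ Fintype.card S} :=
    (List.finite_length_le S (Fintype.card S)).to_subtype
  exact Finite.of_injective
    (fun γ => (⟨φ γ, hφlen γ⟩ : {l : List S // l.length ≤ Fintype.card S}))
    fun γ γ' h => hφinj (congrArg Subtype.val h)

/-- REGISTERED SUB-GOAL `stub_finite` (the finiteness half of `StepMonotone`, recorded on the crux item so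
that this vocabulary file lands as a `--supports` proof): for `δ > 0` the chord type of every `(C, δ, a, b)`
is finite. [folklore] -/
theorem stub_finite : ∀ (δ : ℝ) (c a b : Site 2) (C : (zdGraph 2).Walk c c), 0 < δ →
    Finite (SAW.DomainSAW (dom C δ) δ a b) :=
  fun _ _ _ _ C hδ => finite_domainSAW C hδ

end Finiteness

end Summit.CriticalPhenomena.SAWScalingLimit.Theorems.LeftRightFKG.CornerLoc

end
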